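import Literature.AlgebraicGeometry.AbelianSchemes.AbelianSchemeFiniteSubgroupTorsionExponent
import Literature.AlgebraicGeometry.AbelianSchemes.PolarizationKernelSubgroupShape
import Literature.AlgebraicGeometry.AbelianSchemes.FiniteSubgroupOrderEqFinrank
import Literature.AlgebraicGeometry.AbelianSchemes.AbelianSchemeKOfLEtaleOfInvertibleOrder
import HarnessLib

/-!
# A finite flat closed subgroup subscheme of an abelian scheme, of constant rank `N` invertible on the base, is killed by `N`;
# the kernel of a finite flat polarisation of rank `N ∈ R^×` is killed by `N` — sketch (O9d)

Layer `Literature/AlgebraicGeometry/AbelianSchemes` (namespace `Literature.AlgebraicGeometry.AbelianSchemes.AbelianSchemeOver(.Polarization)`).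
THEOREMS ONLY (no definition, no named fact, no instance, no notation, no `sorry`).  Cell `hodgecm-mathlib` (D-0151), sub-desk P6b
census (O9) brick **(O9d)** = the assembly (S) of the (O9′-ker) chain over a GENERAL affine base `Spec R` (no characteristic hypothesis,
no one-point hypothesis): for `i : Z ↪ A` a finite FLAT closed subgroup subscheme (unit ∕ multiplication ∕ inverse factor through `Z`) of
constant rank `N` (Mathlib `Scheme.Hom.finrank`, [StacksProject] 02KA) with `N ∈ R^×`:
* §1 `formallyUnramified_hom_of_finrank_eq_of_isUnit` — `Z → Spec R` is FORMALLY UNRAMIFIED: every field fibre `Z_t` is ÉTALE (its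
  order is `N`, ★ (O9c) `order_finiteSubgroupSubschemeFibre_eq_of_finrank_eq`; it is killed by its order, DELIGNE, ★ U1
  `FiniteSubgroupSubscheme.emb_pow_order`, [GortzWedhorn2023] Prop. 27.86; `N ≠ 0` in `K`, ★ `natCast_ne_zero_of_isUnit_specMap`; so ★ U2
  `etale_hom_of_pow_eq_one` applies, [MumfordAV1970] §7 Thm. 4, [GortzWedhorn2023] Cor. 27.63), and one field point passes through each `s`
  (★ `formallyUnramified_left_of_forall_exists_fieldPoint`, [EGAIV4] Thm. 17.4.1); `etale_hom_of_finrank_eq_of_isUnit` — ÉTALE (`R` Noetherian);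
  `pow_eq_one_of_finrank_eq_of_isUnit` — **`i ^ N = 1` in `A(Z)`** (★ (O9a) = (T3′) `pow_eq_one_of_forall_order_dvd`: open unit section +
  Deligne on the fibres, [MumfordAV1970] §13, [EGAIV4] Cor. 17.4.2), and `comp_pow_eq_one_of_finrank_eq_of_isUnit` for `T`-valued points.
* §2 `Polarization.kerι_pow_eq_one_of_finrank_lam_eq` — for a finite flat polarisation `λ` of constant rank `N` ([MumfordFogartyKirwan1994]
  Def. 7.2 (ii): `N = d²`) with `N ∈ R^×`: **`Ker λ` is killed by `N`** (`ι_{Ker λ} ^ N = 1`; ★ (O9b′) `PolarizationKernelSubgroupShape` for the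
  subgroup shape of `Ker λ`, ★ (O9c) `Polarization.finrank_ker_hom_eq_of_finrank_lam_eq` for its rank), and
  `Polarization.comp_lam_eq_one_imp_pow_eq_one_of_finrank_lam_eq` — every `u : T → A` with `u ≫ λ = 1` satisfies `u ^ N = 1`
  (★ `GroupSchemeKernel.kerLift`), the currency ★ (O9′) `KerLamKilledOfHasDegree` ∕ ★ (O8d) `exists_abelianLift_of_isUnit_two_of_letter` consume.
HC_CM is proved only modulo the printed citations until rung 0 closes; nothing here is about HC.

## References
* [GortzWedhorn2023] U. Görtz, T. Wedhorn, *Algebraic Geometry II* (2023), Prop. 27.86 (p. 633), Cor. 27.63, Prop. 27.187, §(27.2) (p. 606).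
* [MumfordAV1970] D. Mumford, *Abelian Varieties* (1970), §7 Thm. 4 (p. 72), §13 (p. 123).
* [MumfordFogartyKirwan1994] D. Mumford, J. Fogarty, F. Kirwan, *GIT*, 3rd ed. (1994), Ch. 7 §2 Def. 7.2 (p. 129), Ch. 6 §2 Prop. 6.13 (iii) (p. 123).
* [EGAIV4] A. Grothendieck, *EGA IV₄* (1967), Thm. 17.4.1, Cor. 17.4.2.
* [StacksProject] The Stacks Project, Tag 02KA, Tag 02G8.
-/

set_option autoImplicit false

noncomputable section

set_option backward.isDefEq.respectTransparency false

open CategoryTheory CategoryTheory.Limits AlgebraicGeometry MonoidalCategory CartesianMonoidalCategory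

open scoped MonObj CategoryTheory.Obj

namespace Literature.AlgebraicGeometry.AbelianSchemes

open Literature.AlgebraicGeometry.Motives Literature.AlgebraicGeometry.Motives.AbelianVariety Literature.AlgebraicGeometry.Limits
  Literature.AlgebraicGeometry.GroupSchemes Literature.AlgebraicGeometry.GroupSchemes.GroupSchemeKernel

namespace AbelianSchemeOver

variable {R : Type} [CommRing R] (A : AbelianSchemeOver (Spec (.of R)))

/-! ## §1 A finite flat closed subgroup subscheme of constant rank `N ∈ R^×` is étale and killed by `N` -/

section KilledByRank

variable {Z : Over (Spec (.of R))} (i : Z ⟶ A.X) [IsClosedImmersion i.left] [IsFinite Z.hom] [Flat Z.hom]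
  (he : ∃ e : 𝟙_ (Over (Spec (.of R))) ⟶ Z, e ≫ i = 1)
  (hm : ∃ m : Z ⊗ Z ⟶ Z, m ≫ i = (fst Z Z ≫ i) * (snd Z Z ≫ i))
  (hn : ∃ n : Z ⟶ Z, n ≫ i = i⁻¹)
  {N : ℕ} (hN : ∀ s : Spec (.of R), Z.hom.finrank s = N) (hu : IsUnit ((N : ℕ) : R))

include he hm hn hN hu in
/-- **`Z → Spec R` is FORMALLY UNRAMIFIED**: through each `s ∈ Spec R` passes a field point `t : Spec K → Spec R` (★
`exists_fieldPoint_residueField`), and the fibre `Z_t → Spec K` is ÉTALE — `Z_t ⊆ A_t` has order `N` (★ (O9c)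
`order_finiteSubgroupSubschemeFibre_eq_of_finrank_eq`), is killed by its order (Deligne, ★ U1 `FiniteSubgroupSubscheme.emb_pow_order`) and
`N ≠ 0` in `K`, so ★ U2 `etale_hom_of_pow_eq_one` applies; conclude by ★ `formallyUnramified_left_of_forall_exists_fieldPoint`.
[cite: EGAIV4, Thm. 17.4.1] [cite: GortzWedhorn2023, Prop. 27.86 (p. 633)] [cite: GortzWedhorn2023, Prop. 27.187 and Cor. 27.63]
[cite: MumfordAV1970, §7 Thm. 4 (p. 72)] -/
theorem formallyUnramified_hom_of_finrank_eq_of_isUnit : FormallyUnramified Z.hom := by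
  -- the field fibres are étale
  have hfib : ∀ {K : Type} [Field K] (t : Spec (.of K) ⟶ Spec (.of R)), Etale ((Over.pullback t).obj Z).hom := by
    intro K _ t
    let D := A.finiteSubgroupSubschemeFibre i he hm hn t
    haveI : IsClosedImmersion D.emb.left := D.isClosedImmersion
    have hordN : D.order = N := A.order_finiteSubgroupSubschemeFibre_eq_of_finrank_eq i he hm hn hN t
    have hord : ((N : ℤ) : K) ≠ 0 := by exact_mod_cast natCast_ne_zero_of_isUnit_specMap t hu
    have hpow : D.emb ^ (N : ℤ) = 1 := by rw [zpow_natCast, ← hordN]; exact D.emb_pow_order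
    exact etale_hom_of_pow_eq_one D.emb (N : ℤ) hord hpow
  have hlft : LocallyOfFiniteType (toUnit Z).left := by rw [Over.toUnit_left]; infer_instance
  have key : FormallyUnramified (toUnit Z).left := by
    refine formallyUnramified_left_of_forall_exists_fieldPoint (toUnit Z) fun s => ?_
    obtain ⟨K, _, t, ht⟩ := exists_fieldPoint_residueField (R := R) s
    refine ⟨K, inferInstance, t, ht, ?_⟩
    haveI : Etale ((Over.pullback t).obj Z).hom := hfib t
    haveI : FormallyUnramified (((Over.pullback t).map (toUnit Z)).left ≫ ((Over.pullback t).obj (𝟙_ _)).hom) := by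
      rw [Over.w]
      exact (Etale.iff_flat_and_formallyUnramified.mp inferInstance).2.1
    exact FormallyUnramified.of_comp _ ((Over.pullback t).obj (𝟙_ (Over (Spec (.of R))))).hom
  rwa [Over.toUnit_left] at key

include he hm hn hN hu in
/-- **… hence ÉTALE over `Spec R`** (`R` Noetherian: unramified + flat + locally of finite presentation). [cite: GortzWedhorn2023, Prop. 27.187 and Cor. 27.63]
[cite: MumfordFogartyKirwan1994, Ch. 6 §2 Prop. 6.13 (iii) (p. 123)] -/
theorem etale_hom_of_finrank_eq_of_isUnit [IsNoetherianRing R] : Etale Z.hom := by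
  haveI := A.formallyUnramified_hom_of_finrank_eq_of_isUnit i he hm hn hN hu
  haveI : LocallyOfFinitePresentation Z.hom := LocallyOfFinitePresentation.iff_locallyOfFiniteType.mpr inferInstance
  exact Etale.of_formallyUnramified_of_flat _

include he hm hn hN hu in
/-- **A finite flat closed subgroup subscheme `i : Z ↪ A` of constant rank `N ∈ R^×` is KILLED BY `N`: `i ^ N = 1` in `A(Z)`** (formally
unramified by the above; every fibre has order `N ∣ N`, ★ (O9c); ★ (T3′) `pow_eq_one_of_forall_order_dvd`). [cite: MumfordAV1970, §13 (p. 123)]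
[cite: GortzWedhorn2023, Prop. 27.86 (p. 633)] [cite: EGAIV4, Cor. 17.4.2] [cite: StacksProject, Tag 02KA] -/
theorem pow_eq_one_of_finrank_eq_of_isUnit : i ^ N = 1 := by
  haveI := A.formallyUnramified_hom_of_finrank_eq_of_isUnit i he hm hn hN hu
  exact A.pow_eq_one_of_forall_order_dvd i he hm hn fun z =>
    (A.order_finiteSubgroupSubschemeFibre_eq_of_finrank_eq i he hm hn hN _).dvd

include he hm hn hN hu in
/-- **… and every `T`-valued point of `Z`, read in `A(T)`, is killed by `N`.** [cite: MumfordAV1970, §13 (p. 123)] [cite: GortzWedhorn2023, Prop. 27.86 (p. 633)] -/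
theorem comp_pow_eq_one_of_finrank_eq_of_isUnit {T : Over (Spec (.of R))} (w : T ⟶ Z) : (w ≫ i) ^ N = 1 :=
  A.comp_pow_eq_one_of_pow_eq_one i (A.pow_eq_one_of_finrank_eq_of_isUnit i he hm hn hN hu) w

end KilledByRank

/-! ## §2 The kernel of a finite flat polarisation of constant rank `N ∈ R^×` is killed by `N` -/

section Kernel

variable {D : A.DualPair} (pol : A.Polarization D) [IsMonHom pol.lam] [IsFinite pol.lam.left] [Flat pol.lam.left]
  {N : ℕ} (hdeg : ∀ y : D.hat.X.left, pol.lam.left.finrank y = N) (hu : IsUnit ((N : ℕ) : R))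

include hdeg hu in
/-- **`ι_{Ker λ} ^ N = 1`: the kernel of a finite flat polarisation of constant rank `N ∈ R^×` is killed by `N`** (`Ker λ ⊆ A` is a finite
flat closed subgroup subscheme, ★ (O9b′); its rank is `N`, ★ (O9c) `Polarization.finrank_ker_hom_eq_of_finrank_lam_eq`; §1).
[cite: MumfordFogartyKirwan1994, Ch. 7 §2 Definition 7.2 (p. 129)] [cite: MumfordAV1970, §13 (p. 123)] [cite: GortzWedhorn2023, Prop. 27.86 (p. 633)] -/
theorem Polarization.kerι_pow_eq_one_of_finrank_lam_eq : kerι pol.lam ^ N = 1 := by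
  haveI : IsClosedImmersion (kerι pol.lam).left := pol.isClosedImmersion_kerι_left A
  haveI : IsFinite (ker pol.lam).hom := pol.isFinite_ker_hom A
  haveI : Flat (ker pol.lam).hom := pol.flat_ker_hom A
  exact A.pow_eq_one_of_finrank_eq_of_isUnit (kerι pol.lam) (pol.exists_one_fac_kerι A) (pol.exists_mul_fac_kerι A)
    (pol.exists_inv_fac_kerι A) (pol.finrank_ker_hom_eq_of_finrank_lam_eq A hdeg) hu

include hdeg hu in
/-- **Every `u : T → A` over `Spec R` with `u ≫ λ = 1` satisfies `u ^ N = 1`** (`u` factors through `Ker λ`, ★ `GroupSchemeKernel.kerLift`) —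
the kernel-killed currency of ★ (O9′) `KerLamKilledOfHasDegree`. [cite: MumfordFogartyKirwan1994, Ch. 7 §2 Definition 7.2 (p. 129)]
[cite: MumfordAV1970, §13 (p. 123) and §23] -/
theorem Polarization.pow_eq_one_of_comp_lam_eq_one_of_finrank_lam_eq {T : Over (Spec (.of R))} (u : T ⟶ A.X)
    (hu1 : u ≫ pol.lam = 1) : u ^ N = 1 := by
  obtain ⟨w, hw⟩ := pol.exists_fac_kerι_of_comp_lam_eq_one A u hu1
  rw [← hw]
  haveI : IsClosedImmersion (kerι pol.lam).left := pol.isClosedImmersion_kerι_left A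
  haveI : IsFinite (ker pol.lam).hom := pol.isFinite_ker_hom A
  exact A.comp_pow_eq_one_of_pow_eq_one (kerι pol.lam) (pol.kerι_pow_eq_one_of_finrank_lam_eq A hdeg hu) w

end Kernel

end AbelianSchemeOver

end Literature.AlgebraicGeometry.AbelianSchemes

end
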